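import Summits.Ventures.CertifiedManyBodySolver.Downfold.TPrimePinnedPairRowKernelWide
import Summits.Ventures.CertifiedManyBodySolver.Rows.CorrWindowCertKernelChainQuotAdjCloser
import Summits.Ventures.CertifiedManyBodySolver.Rows.CorrWindowCertKernelEomLocality
import HarnessLib

/-!
# The PINNED t′-PAIR shape from TWO hinted-quotient + ADJOINT chains (`stepEQA`) over EOM-NEAR sliced residuals, on ANY outer letter
# window `Λ' ⊇ Λ₇ = box 2 7` — `SquareTTPrimePinnedPairRowT.of_quotAdjChainNearKernelCertsG_wide` (abstract Gram slices) and
# `…of_quotAdjChainNearKernelCerts_tb_wide` (two-level Gram), plus the PLAIN-slice edition `…of_quotAdjChainKernelCerts_tb_wide` (no eom masks);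
# cell `pub/hubbard-obs` × `pub/hubbard-downfold`, D-0154 (1)(C) COVERAGE La214; seat `hubbard-cov-la214-unc-2`, lineage desk; zero compute

HONEST FRAMING: Lean plumbing towards «tier P» for PAIR claim nodes‴ — the T-shape PAIR twin of hubbard-obs-p2's single-vertex CLOSER OF RECORD
for u′ certificates (`CARPolyWindow.affineOrbitLowerRowN_of_quotAdjChainKernelCert{G,TB}Near`: the `stepEQA` step of
`Rows/CorrWindowCertKernelChainQuotAdj.lean` (p677450) run over the residual sliced with EOM-NEAR slices, `Rows/CorrWindowCertKernelEomLocality.lean`).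
Per vertex: the hinted chain `ChainQAOK D Bkey M Cs (groupSlices (residTGslicesNear … TGs TH D.f EB masks ∅ ∅ CW AV) ns) Hs` started from the empty
accumulator, the per-generator MASKS of near Hamiltonian terms with the decidable far check `hfar : eomFarOK TH D.f EB masks = true`, Gram slices
`TGs` denoting a `gramForm Λm O` with `Λm ⪰ 0` (abstract; the contracted-Gram instance fills the slot) or the two-level `gramTBslices K blocks`
(PSD by construction), and ONE decidable price `β ≤ lowerConst (decPoly N C_M) + (μ 0 + μ 1)(n₀/2 − ν)`; BOTH vertices over the SAME tables
`D : QuotData N Nβ` on the outer window `Λ'` (`hxs : D.xs i ∈ Λ'`, e.g. `box 2 12`), letters `d : Orb (Fin N) → Orb (PolySite Λ')`, objectives the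
embedded words `Γ(incl h7)(X s_v)`, ONE shared eom word list `EB` ⟹ `SquareTTPrimePinnedPairRowT U n₀ sA sB capA capB flA flB βA κA κA' βB κB κB' X`
via this base's `SquareTTPrimePinnedPairRowT.of_residPolys_wide` (p678325). Proof per vertex = hubbard-obs-p2's closer lines (accepted family
`allMovesZ`, recorded adjoint generators `allAdj`, `annotate_ok`, `shiftSet_subset_of_table`, `d_gq`, `evalPoly_chainQA_nil`,
`termOp_flatten_residTGslicesNear`, `termOp_residTG_moves_adj`, `termOp_symTL_eq`); `S = D₄` for the pair shape, so no `hokS`.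
Nothing is asserted: no `def`, no named fact, no `sorry`, no number; no chain of record exists (nothing evaluated); CONTROL / CALIBRATION wording
class (xx1); no summit statement is proved by this file.

References: X. Han, arXiv:2006.06002 §3 [Han2020Bootstrap]; J. Wang et al., PRX 14 (2024) 031006 §III [WangEtAl2024]; C. Jansson, D. Chaykin,
C. Keil, SIAM J. Numer. Anal. 46 (2008) 180 [JanssonChaykinKeil2008]; D. P. Bertsekas, *Nonlinear Programming* (1999) Prop. 5.1.3
[Bertsekas1999NonlinearProgramming]; O. Bratteli, D. W. Robinson, *Operator Algebras and Quantum Statistical Mechanics 2* §5.2.2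
[BratteliRobinsonII1997].
-/

noncomputable section

namespace Summit.Ventures.CertifiedManyBodySolver.Downfold

open Literature.MathematicalPhysics.QuantumLattice
open Matrix HubbardWave0 Literature.Probability.LatticeModels ThermodynamicLimit Filter Topology
open Literature.MathematicalPhysics.QuantumManyBody.StateRelaxation
open Summit.Ventures.CertifiedQuantumChemistry Summit.Ventures.CertifiedQuantumChemistry.CARPoly
open Summit.Ventures.CertifiedManyBodySolver.CARPolyWindow
open scoped BigOperators ComplexOrder

/-! ## §1 TWO `stepEQA` chains over EOM-NEAR sliced residuals, ABSTRACT Gram slices, outer window `Λ' ⊇ Λ₇` ⇒ the pinned t′-pair shape -/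

section KernelPairChainQuotAdjNearG

variable {N Nβ : ℕ} [NeZero N]

/-- **KERNEL FORM OF THE PAIR NODE‴ — CLOSER-OF-RECORD INPUT SHAPE, ABSTRACT GRAM SLICES, WIDE WINDOW.** Shared: station `(U, n₀)` rational,
hoppings `sA, sB`, windows `Λ ⊆ Λ' ⊇ box 2 7`, tables `D : QuotData N Nβ` on `Λ'` with their specifications (`hxs hix hxsβ hcovβ`), letters `d`/`dΛ`
in table form, the table licence fact `hokV` (decidable), origin letters, the objective family `X` (words on `box 2 7`, embedded by `incl h7`), ONE
eom word list `EB`; per vertex: dictionaries at `(1, s_v, U)`, objective `termOp d TX_v = Γ(incl h7)(X s_v)`, density rows, cap/cut rows, Gram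
slices `TGs_v` with `termOp d TGs_v.flatten = gramForm Λm_v O_v`, `Λm_v ⪰ 0`, eom-near masks with the far check, charged words, anti-Hermitian
parts, the hinted + adjoint chain `(ns, M, Cs, hC0, Hs, hchain)` over `residTGslicesNear`, and the price `hβ_v`
⟹ `SquareTTPrimePinnedPairRowT U n₀ sA sB capA capB flA flB βA κA κA' βB κB κB' X`.
[cite: WangEtAl2024, §III] [cite: Han2020Bootstrap, §3] [cite: JanssonChaykinKeil2008, §3] [cite: Bertsekas1999NonlinearProgramming, Prop. 5.1.3]
[cite: BratteliRobinsonII1997, §5.2.2] -/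
theorem SquareTTPrimePinnedPairRowT.of_quotAdjChainNearKernelCertsG_wide
    (U : ℚ) (hU : 0 ≤ U) (n₀ : ℚ) (hn0 : 0 ≤ n₀) (hn2 : n₀ < 2) (sA sB : ℚ)
    {Λ Λ' : Finset (Site 2)} (h7 : box 2 7 ⊆ Λ') (hΛ : Λ ⊆ Λ') (h8 : thicken Λ 1 ⊆ Λ')
    (h0 : thicken ({0} : Finset (Site 2)) 1 ⊆ Λ') (hz : (0 : Site 2) ∈ Λ')
    -- tables and letters (shared)
    (D : QuotData N Nβ) (hxs : ∀ i, D.xs i ∈ Λ') (hix : ∀ y ∈ Λ', D.xs (D.ix y) = y)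
    (hxsβ : ∀ j, D.xsβ j ∈ Λ) (hcovβ : ∀ x ∈ Λ, ∃ j, D.xsβ j = x)
    (d : Orb (Fin N) → Orb (PolySite Λ')) (hd : Function.Injective d)
    (hdx : ∀ i σ, d (orb i σ) = orb (PolySite.pt (D.xs i) (hxs i)) σ) (Bkey : ℕ)
    (dΛ : Orb (Fin Nβ) → Orb (PolySite Λ)) (hdΛ : ∀ j σ, dΛ (orb j σ) = orb (PolySite.pt (D.xsβ j) (hxsβ j)) σ)
    (hf : ∀ b, d (D.f b) = Orb.embMap (PolySite.incl hΛ) (dΛ b))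
    (sp : Orb (Fin N) → Fin 2) (hsp : ∀ a, (ofLex (d a)).2 = sp a)
    (hokV : ∀ γc v, D.ok γc v = true →
      ∀ j : Fin Nβ, D.xs (D.ix (d4Vec (d4OfCode γc) (D.xsβ j) + siteOfPair v)) = d4Vec (d4OfCode γc) (D.xsβ j) + siteOfPair v)
    (o : Fin 2 → Orb (Fin N)) (ho : ∀ σ, d (o σ) = orb (PolySite.pt 0 hz) σ)
    -- the objective family and the SHARED eom words
    (X : ℝ → FermionOp (box 2 7)) (EB : List (Terms (Orb (Fin Nβ))))
    -- vertex A
    (THA : Terms (Orb (Fin N))) (hHA : termOp d THA = (hubbardTTPrimeFermionInteraction 1 (sA : ℝ) (U : ℝ)).localHamiltonian Λ')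
    (TEA : Terms (Orb (Fin N)))
    (hEA : termOp d TEA = fermionEmbed (PolySite.incl h0) ((hubbardTTPrimeFermionInteraction 1 (sA : ℝ) (U : ℝ)).meanEnergyObs 1))
    (TXA : Terms (Orb (Fin N))) (hXA : termOp d TXA = fermionEmbed (PolySite.incl h7) (X (sA : ℝ)))
    (μA : Fin 2 → ℚ) (νA κA capA κA' flA : ℚ)
    (TGsA : List (Terms (Orb (Fin N)))) {mA : Type*} [Fintype mA] [DecidableEq mA] {ΛmA : Matrix mA mA ℂ} (hΛmA : ΛmA.PosSemidef)
    (OA : mA → FermionOp Λ') (hTGA : termOp d TGsA.flatten = gramForm ΛmA OA)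
    (masksA : List (List Bool)) (hfarA : eomFarOK THA D.f EB masksA = true)
    (CWA : Terms (Orb (Fin N))) (hcwA : ∀ wc ∈ CWA, chargeW wc.1 ≠ 0 ∨ spinChargeW sp wc.1 ≠ 0)
    (AVA : List (Terms (Orb (Fin N))))
    (nsA : List ℕ) (MA : ℕ) (CsA : List SOSDual.EncPoly) (hC0A : CsA.getD 0 [] = []) (HsA : List (List (QHint Nβ)))
    (hchainA : ChainQAOK D Bkey MA CsA
      (groupSlices (residTGslicesNear TXA μA νA o κA capA κA' flA TEA TGsA THA D.f EB masksA
        (fun l : Fin 0 => l.elim0) (fun l : Fin 0 => l.elim0) CWA AVA) nsA) HsA)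
    {βA : ℚ} (hβA : βA ≤ lowerConst (SOSDual.decPoly N (CsA.getD MA [])) + (μA 0 + μA 1) * (n₀ / 2 - νA))
    -- vertex B
    (THB : Terms (Orb (Fin N))) (hHB : termOp d THB = (hubbardTTPrimeFermionInteraction 1 (sB : ℝ) (U : ℝ)).localHamiltonian Λ')
    (TEB : Terms (Orb (Fin N)))
    (hEB : termOp d TEB = fermionEmbed (PolySite.incl h0) ((hubbardTTPrimeFermionInteraction 1 (sB : ℝ) (U : ℝ)).meanEnergyObs 1))
    (TXB : Terms (Orb (Fin N))) (hXB : termOp d TXB = fermionEmbed (PolySite.incl h7) (X (sB : ℝ)))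
    (μB : Fin 2 → ℚ) (νB κB capB κB' flB : ℚ)
    (TGsB : List (Terms (Orb (Fin N)))) {mB : Type*} [Fintype mB] [DecidableEq mB] {ΛmB : Matrix mB mB ℂ} (hΛmB : ΛmB.PosSemidef)
    (OB : mB → FermionOp Λ') (hTGB : termOp d TGsB.flatten = gramForm ΛmB OB)
    (masksB : List (List Bool)) (hfarB : eomFarOK THB D.f EB masksB = true)
    (CWB : Terms (Orb (Fin N))) (hcwB : ∀ wc ∈ CWB, chargeW wc.1 ≠ 0 ∨ spinChargeW sp wc.1 ≠ 0)
    (AVB : List (Terms (Orb (Fin N))))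
    (nsB : List ℕ) (MB : ℕ) (CsB : List SOSDual.EncPoly) (hC0B : CsB.getD 0 [] = []) (HsB : List (List (QHint Nβ)))
    (hchainB : ChainQAOK D Bkey MB CsB
      (groupSlices (residTGslicesNear TXB μB νB o κB capB κB' flB TEB TGsB THB D.f EB masksB
        (fun l : Fin 0 => l.elim0) (fun l : Fin 0 => l.elim0) CWB AVB) nsB) HsB)
    {βB : ℚ} (hβB : βB ≤ lowerConst (SOSDual.decPoly N (CsB.getD MB [])) + (μB 0 + μB 1) * (n₀ / 2 - νB)) :
    SquareTTPrimePinnedPairRowT (U : ℝ) (n₀ : ℝ) (sA : ℝ) (sB : ℝ) capA capB flA flB βA κA κA' βB κB κB' X := by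
  -- vertex A: the accepted move family of its hinted chain, the recorded adjoint generators, the licences, the semantic residual
  set TsA := groupSlices (residTGslicesNear TXA μA νA o κA capA κA' flA TEA TGsA THA D.f EB masksA
    (fun l : Fin 0 => l.elim0) (fun l : Fin 0 => l.elim0) CWA AVA) nsA with hTsA
  set LA := allMovesZ D Bkey TsA HsA MA with hLA
  set LAA := allAdj D Bkey TsA HsA MA with hLAA
  have hLokA : ∀ n, ∀ mv ∈ allMovesZ D Bkey TsA HsA n, D.ok mv.1 mv.2.1 = true := by
    intro n
    induction n with
    | zero => intro mv hmv; rw [allMovesZ_zero] at hmv; exact absurd hmv List.not_mem_nil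
    | succ n ih =>
      intro mv hmv
      rw [allMovesZ_succ, List.mem_append] at hmv
      rcases hmv with hmv | hmv
      · exact ih mv hmv
      · rw [movesOfZ, quotMovesZ, List.mem_filterMap] at hmv
        obtain ⟨a, ha, hmap⟩ := hmv
        obtain ⟨e, hae, hFe⟩ := Option.map_eq_some_iff.1 hmap
        obtain ⟨hok, -, -⟩ := annotate_ok D Bkey _ _ a ha e hae
        rw [← hFe]
        exact hok
  let γfA : Fin LA.length → DihedralGroup 4 := fun l => d4OfCode (LA.get l).1
  let wvfA : Fin LA.length → Site 2 := fun l => siteOfPair (LA.get l).2.1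
  let gfA : Fin LA.length → Orb (Fin Nβ) → Orb (Fin N) := fun l => gq D (γfA l) (wvfA l)
  let SYfA : Fin LA.length → Terms (Orb (Fin Nβ)) := fun l => (LA.get l).2.2
  have hshA : ∀ l, d4ShiftSet (γfA l) (wvfA l) Λ ⊆ Λ' := fun l =>
    shiftSet_subset_of_table D hxs hcovβ (γfA l) (wvfA l) (hokV _ _ (hLokA MA _ (List.get_mem LA l)))
  have hgA : ∀ l b, d (gfA l b) = Orb.embMap (PolySite.incl (hshA l)) (Orb.embMap (PolySite.d4Emb (γfA l) (wvfA l) Λ) (dΛ b)) :=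
    fun l b => by rw [← orb_ofLex_eq b]; exact d_gq D hxs d hdx hix hxsβ dΛ hdΛ (γfA l) (wvfA l) (hshA l) _ _
  have hRA : evalPoly d (SOSDual.decPoly N (CsA.getD MA [])) =
      termOp d (residTG TXA μA νA o κA capA κA' flA TEA TGsA.flatten THA D.f EB gfA SYfA CWA (AVA ++ LAA)) := by
    rw [evalPoly_chainQA_nil hd hC0A hchainA, hTsA, flatten_groupSlices,
      termOp_flatten_residTGslicesNear hd TXA μA νA o κA capA κA' flA TEA _ THA D.f EB masksA _ _ CWA AVA hfarA,
      termOp_residTG_moves_adj d TXA μA νA o κA capA κA' flA TEA _ THA D.f EB gfA SYfA CWA AVA LAA, ← hLA, ← hLAA,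
      termOp_symTL_eq]
  -- vertex B: the accepted move family of its hinted chain, the recorded adjoint generators, the licences, the semantic residual
  set TsB := groupSlices (residTGslicesNear TXB μB νB o κB capB κB' flB TEB TGsB THB D.f EB masksB
    (fun l : Fin 0 => l.elim0) (fun l : Fin 0 => l.elim0) CWB AVB) nsB with hTsB
  set LB := allMovesZ D Bkey TsB HsB MB with hLB
  set LAB := allAdj D Bkey TsB HsB MB with hLAB
  have hLokB : ∀ n, ∀ mv ∈ allMovesZ D Bkey TsB HsB n, D.ok mv.1 mv.2.1 = true := by
    intro n
    induction n with
    | zero => intro mv hmv; rw [allMovesZ_zero] at hmv; exact absurd hmv List.not_mem_nil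
    | succ n ih =>
      intro mv hmv
      rw [allMovesZ_succ, List.mem_append] at hmv
      rcases hmv with hmv | hmv
      · exact ih mv hmv
      · rw [movesOfZ, quotMovesZ, List.mem_filterMap] at hmv
        obtain ⟨a, ha, hmap⟩ := hmv
        obtain ⟨e, hae, hFe⟩ := Option.map_eq_some_iff.1 hmap
        obtain ⟨hok, -, -⟩ := annotate_ok D Bkey _ _ a ha e hae
        rw [← hFe]
        exact hok
  let γfB : Fin LB.length → DihedralGroup 4 := fun l => d4OfCode (LB.get l).1
  let wvfB : Fin LB.length → Site 2 := fun l => siteOfPair (LB.get l).2.1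
  let gfB : Fin LB.length → Orb (Fin Nβ) → Orb (Fin N) := fun l => gq D (γfB l) (wvfB l)
  let SYfB : Fin LB.length → Terms (Orb (Fin Nβ)) := fun l => (LB.get l).2.2
  have hshB : ∀ l, d4ShiftSet (γfB l) (wvfB l) Λ ⊆ Λ' := fun l =>
    shiftSet_subset_of_table D hxs hcovβ (γfB l) (wvfB l) (hokV _ _ (hLokB MB _ (List.get_mem LB l)))
  have hgB : ∀ l b, d (gfB l b) = Orb.embMap (PolySite.incl (hshB l)) (Orb.embMap (PolySite.d4Emb (γfB l) (wvfB l) Λ) (dΛ b)) :=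
    fun l b => by rw [← orb_ofLex_eq b]; exact d_gq D hxs d hdx hix hxsβ dΛ hdΛ (γfB l) (wvfB l) (hshB l) _ _
  have hRB : evalPoly d (SOSDual.decPoly N (CsB.getD MB [])) =
      termOp d (residTG TXB μB νB o κB capB κB' flB TEB TGsB.flatten THB D.f EB gfB SYfB CWB (AVB ++ LAB)) := by
    rw [evalPoly_chainQA_nil hd hC0B hchainB, hTsB, flatten_groupSlices,
      termOp_flatten_residTGslicesNear hd TXB μB νB o κB capB κB' flB TEB _ THB D.f EB masksB _ _ CWB AVB hfarB,
      termOp_residTG_moves_adj d TXB μB νB o κB capB κB' flB TEB _ THB D.f EB gfB SYfB CWB AVB LAB, ← hLB, ← hLAB,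
      termOp_symTL_eq]
  exact SquareTTPrimePinnedPairRowT.of_residPolys_wide U hU n₀ hn0 hn2 sA sB h7 hΛ h8 h0 hz d dΛ D.f hf sp hsp o ho X EB
    THA hHA TEA hEA TXA hXA μA νA κA capA κA' flA TGsA.flatten hΛmA OA hTGA γfA wvfA hshA gfA hgA SYfA CWA hcwA (AVA ++ LAA) hRA hβA
    THB hHB TEB hEB TXB hXB μB νB κB capB κB' flB TGsB.flatten hΛmB OB hTGB γfB wvfB hshB gfB hgB SYfB CWB hcwB (AVB ++ LAB) hRB hβB

end KernelPairChainQuotAdjNearG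

/-! ## §2 The two-level Gram corollary (`TGs := gramTBslices K blocks`, PSD by construction) -/

section KernelPairChainQuotAdjNearTB

variable {N Nβ : ℕ} [NeZero N]

/-- **KERNEL FORM OF THE PAIR NODE‴ — CLOSER-OF-RECORD INPUT SHAPE, TWO-LEVEL GRAM, WIDE WINDOW**: as
`SquareTTPrimePinnedPairRowT.of_quotAdjChainNearKernelCertsG_wide` with `TGs_v := gramTBslices K_v blocks_v` (positivity inherited from
`gramTBCoef_posSemidef`, no obligation on the instance). [cite: WangEtAl2024, §III] [cite: Han2020Bootstrap, §3] [cite: JanssonChaykinKeil2008, §3]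
[cite: Bertsekas1999NonlinearProgramming, Prop. 5.1.3] -/
theorem SquareTTPrimePinnedPairRowT.of_quotAdjChainNearKernelCerts_tb_wide
    (U : ℚ) (hU : 0 ≤ U) (n₀ : ℚ) (hn0 : 0 ≤ n₀) (hn2 : n₀ < 2) (sA sB : ℚ)
    {Λ Λ' : Finset (Site 2)} (h7 : box 2 7 ⊆ Λ') (hΛ : Λ ⊆ Λ') (h8 : thicken Λ 1 ⊆ Λ')
    (h0 : thicken ({0} : Finset (Site 2)) 1 ⊆ Λ') (hz : (0 : Site 2) ∈ Λ')
    -- tables and letters (shared)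
    (D : QuotData N Nβ) (hxs : ∀ i, D.xs i ∈ Λ') (hix : ∀ y ∈ Λ', D.xs (D.ix y) = y)
    (hxsβ : ∀ j, D.xsβ j ∈ Λ) (hcovβ : ∀ x ∈ Λ, ∃ j, D.xsβ j = x)
    (d : Orb (Fin N) → Orb (PolySite Λ')) (hd : Function.Injective d)
    (hdx : ∀ i σ, d (orb i σ) = orb (PolySite.pt (D.xs i) (hxs i)) σ) (Bkey : ℕ)
    (dΛ : Orb (Fin Nβ) → Orb (PolySite Λ)) (hdΛ : ∀ j σ, dΛ (orb j σ) = orb (PolySite.pt (D.xsβ j) (hxsβ j)) σ)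
    (hf : ∀ b, d (D.f b) = Orb.embMap (PolySite.incl hΛ) (dΛ b))
    (sp : Orb (Fin N) → Fin 2) (hsp : ∀ a, (ofLex (d a)).2 = sp a)
    (hokV : ∀ γc v, D.ok γc v = true →
      ∀ j : Fin Nβ, D.xs (D.ix (d4Vec (d4OfCode γc) (D.xsβ j) + siteOfPair v)) = d4Vec (d4OfCode γc) (D.xsβ j) + siteOfPair v)
    (o : Fin 2 → Orb (Fin N)) (ho : ∀ σ, d (o σ) = orb (PolySite.pt 0 hz) σ)
    -- the objective family and the SHARED eom words
    (X : ℝ → FermionOp (box 2 7)) (EB : List (Terms (Orb (Fin Nβ))))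
    -- vertex A
    (THA : Terms (Orb (Fin N))) (hHA : termOp d THA = (hubbardTTPrimeFermionInteraction 1 (sA : ℝ) (U : ℝ)).localHamiltonian Λ')
    (TEA : Terms (Orb (Fin N)))
    (hEA : termOp d TEA = fermionEmbed (PolySite.incl h0) ((hubbardTTPrimeFermionInteraction 1 (sA : ℝ) (U : ℝ)).meanEnergyObs 1))
    (TXA : Terms (Orb (Fin N))) (hXA : termOp d TXA = fermionEmbed (PolySite.incl h7) (X (sA : ℝ)))
    (μA : Fin 2 → ℚ) (νA κA capA κA' flA : ℚ)
    (KA : ℕ) (blocksA : List (List (List ℤ × Terms (Orb (Fin N)))))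
    (masksA : List (List Bool)) (hfarA : eomFarOK THA D.f EB masksA = true)
    (CWA : Terms (Orb (Fin N))) (hcwA : ∀ wc ∈ CWA, chargeW wc.1 ≠ 0 ∨ spinChargeW sp wc.1 ≠ 0)
    (AVA : List (Terms (Orb (Fin N))))
    (nsA : List ℕ) (MA : ℕ) (CsA : List SOSDual.EncPoly) (hC0A : CsA.getD 0 [] = []) (HsA : List (List (QHint Nβ)))
    (hchainA : ChainQAOK D Bkey MA CsA
      (groupSlices (residTGslicesNear TXA μA νA o κA capA κA' flA TEA (gramTBslices KA blocksA) THA D.f EB masksA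
        (fun l : Fin 0 => l.elim0) (fun l : Fin 0 => l.elim0) CWA AVA) nsA) HsA)
    {βA : ℚ} (hβA : βA ≤ lowerConst (SOSDual.decPoly N (CsA.getD MA [])) + (μA 0 + μA 1) * (n₀ / 2 - νA))
    -- vertex B
    (THB : Terms (Orb (Fin N))) (hHB : termOp d THB = (hubbardTTPrimeFermionInteraction 1 (sB : ℝ) (U : ℝ)).localHamiltonian Λ')
    (TEB : Terms (Orb (Fin N)))
    (hEB : termOp d TEB = fermionEmbed (PolySite.incl h0) ((hubbardTTPrimeFermionInteraction 1 (sB : ℝ) (U : ℝ)).meanEnergyObs 1))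
    (TXB : Terms (Orb (Fin N))) (hXB : termOp d TXB = fermionEmbed (PolySite.incl h7) (X (sB : ℝ)))
    (μB : Fin 2 → ℚ) (νB κB capB κB' flB : ℚ)
    (KB : ℕ) (blocksB : List (List (List ℤ × Terms (Orb (Fin N)))))
    (masksB : List (List Bool)) (hfarB : eomFarOK THB D.f EB masksB = true)
    (CWB : Terms (Orb (Fin N))) (hcwB : ∀ wc ∈ CWB, chargeW wc.1 ≠ 0 ∨ spinChargeW sp wc.1 ≠ 0)
    (AVB : List (Terms (Orb (Fin N))))
    (nsB : List ℕ) (MB : ℕ) (CsB : List SOSDual.EncPoly) (hC0B : CsB.getD 0 [] = []) (HsB : List (List (QHint Nβ)))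
    (hchainB : ChainQAOK D Bkey MB CsB
      (groupSlices (residTGslicesNear TXB μB νB o κB capB κB' flB TEB (gramTBslices KB blocksB) THB D.f EB masksB
        (fun l : Fin 0 => l.elim0) (fun l : Fin 0 => l.elim0) CWB AVB) nsB) HsB)
    {βB : ℚ} (hβB : βB ≤ lowerConst (SOSDual.decPoly N (CsB.getD MB [])) + (μB 0 + μB 1) * (n₀ / 2 - νB)) :
    SquareTTPrimePinnedPairRowT (U : ℝ) (n₀ : ℝ) (sA : ℝ) (sB : ℝ) capA capB flA flB βA κA κA' βB κB κB' X := by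
  have hTGA : termOp d (gramTBslices KA blocksA).flatten = gramForm (gramTBCoef KA blocksA) (gramTBOp d blocksA) := by
    rw [flatten_gramTBslices, termOp_gramTB_eq_gramForm]
  have hTGB : termOp d (gramTBslices KB blocksB).flatten = gramForm (gramTBCoef KB blocksB) (gramTBOp d blocksB) := by
    rw [flatten_gramTBslices, termOp_gramTB_eq_gramForm]
  exact SquareTTPrimePinnedPairRowT.of_quotAdjChainNearKernelCertsG_wide U hU n₀ hn0 hn2 sA sB h7 hΛ h8 h0 hz D hxs hix hxsβ hcovβ d hd hdx
    Bkey dΛ hdΛ hf sp hsp hokV o ho X EB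
    THA hHA TEA hEA TXA hXA μA νA κA capA κA' flA (gramTBslices KA blocksA) (gramTBCoef_posSemidef KA blocksA) (gramTBOp d blocksA) hTGA
    masksA hfarA CWA hcwA AVA nsA MA CsA hC0A HsA hchainA hβA
    THB hHB TEB hEB TXB hXB μB νB κB capB κB' flB (gramTBslices KB blocksB) (gramTBCoef_posSemidef KB blocksB) (gramTBOp d blocksB) hTGB
    masksB hfarB CWB hcwB AVB nsB MB CsB hC0B HsB hchainB hβB

end KernelPairChainQuotAdjNearTB

/-! ## §3 The PLAIN hinted-quotient + adjoint edition (no eom masks: full `[H_{Λ'}, Γ B_k]` slices), two-level Gram, wide window — for toys and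
small instances that do not need eom locality -/

section KernelPairChainQuotAdjTB

variable {N Nβ : ℕ} [NeZero N]

/-- **KERNEL FORM OF THE PAIR NODE‴ — `stepEQA` chains over the PLAIN sliced residual (`residTGslices`, no masks), TWO-LEVEL GRAM, WIDE WINDOW**:
the T-shape pair twin of `CARPolyWindow.affineOrbitLowerRowN_of_quotAdjChainKernelCertTB` (p677853) on any `Λ' ⊇ box 2 7`.
[cite: WangEtAl2024, §III] [cite: Han2020Bootstrap, §3] [cite: JanssonChaykinKeil2008, §3] [cite: Bertsekas1999NonlinearProgramming, Prop. 5.1.3] -/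
theorem SquareTTPrimePinnedPairRowT.of_quotAdjChainKernelCerts_tb_wide
    (U : ℚ) (hU : 0 ≤ U) (n₀ : ℚ) (hn0 : 0 ≤ n₀) (hn2 : n₀ < 2) (sA sB : ℚ)
    {Λ Λ' : Finset (Site 2)} (h7 : box 2 7 ⊆ Λ') (hΛ : Λ ⊆ Λ') (h8 : thicken Λ 1 ⊆ Λ')
    (h0 : thicken ({0} : Finset (Site 2)) 1 ⊆ Λ') (hz : (0 : Site 2) ∈ Λ')
    -- tables and letters (shared)
    (D : QuotData N Nβ) (hxs : ∀ i, D.xs i ∈ Λ') (hix : ∀ y ∈ Λ', D.xs (D.ix y) = y)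
    (hxsβ : ∀ j, D.xsβ j ∈ Λ) (hcovβ : ∀ x ∈ Λ, ∃ j, D.xsβ j = x)
    (d : Orb (Fin N) → Orb (PolySite Λ')) (hd : Function.Injective d)
    (hdx : ∀ i σ, d (orb i σ) = orb (PolySite.pt (D.xs i) (hxs i)) σ) (Bkey : ℕ)
    (dΛ : Orb (Fin Nβ) → Orb (PolySite Λ)) (hdΛ : ∀ j σ, dΛ (orb j σ) = orb (PolySite.pt (D.xsβ j) (hxsβ j)) σ)
    (hf : ∀ b, d (D.f b) = Orb.embMap (PolySite.incl hΛ) (dΛ b))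
    (sp : Orb (Fin N) → Fin 2) (hsp : ∀ a, (ofLex (d a)).2 = sp a)
    (hokV : ∀ γc v, D.ok γc v = true →
      ∀ j : Fin Nβ, D.xs (D.ix (d4Vec (d4OfCode γc) (D.xsβ j) + siteOfPair v)) = d4Vec (d4OfCode γc) (D.xsβ j) + siteOfPair v)
    (o : Fin 2 → Orb (Fin N)) (ho : ∀ σ, d (o σ) = orb (PolySite.pt 0 hz) σ)
    -- the objective family and the SHARED eom words
    (X : ℝ → FermionOp (box 2 7)) (EB : List (Terms (Orb (Fin Nβ))))
    -- vertex A
    (THA : Terms (Orb (Fin N))) (hHA : termOp d THA = (hubbardTTPrimeFermionInteraction 1 (sA : ℝ) (U : ℝ)).localHamiltonian Λ')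
    (TEA : Terms (Orb (Fin N)))
    (hEA : termOp d TEA = fermionEmbed (PolySite.incl h0) ((hubbardTTPrimeFermionInteraction 1 (sA : ℝ) (U : ℝ)).meanEnergyObs 1))
    (TXA : Terms (Orb (Fin N))) (hXA : termOp d TXA = fermionEmbed (PolySite.incl h7) (X (sA : ℝ)))
    (μA : Fin 2 → ℚ) (νA κA capA κA' flA : ℚ)
    (KA : ℕ) (blocksA : List (List (List ℤ × Terms (Orb (Fin N)))))
    (CWA : Terms (Orb (Fin N))) (hcwA : ∀ wc ∈ CWA, chargeW wc.1 ≠ 0 ∨ spinChargeW sp wc.1 ≠ 0)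
    (AVA : List (Terms (Orb (Fin N))))
    (nsA : List ℕ) (MA : ℕ) (CsA : List SOSDual.EncPoly) (hC0A : CsA.getD 0 [] = []) (HsA : List (List (QHint Nβ)))
    (hchainA : ChainQAOK D Bkey MA CsA
      (groupSlices (residTGslices TXA μA νA o κA capA κA' flA TEA (gramTBslices KA blocksA) THA D.f EB
        (fun l : Fin 0 => l.elim0) (fun l : Fin 0 => l.elim0) CWA AVA) nsA) HsA)
    {βA : ℚ} (hβA : βA ≤ lowerConst (SOSDual.decPoly N (CsA.getD MA [])) + (μA 0 + μA 1) * (n₀ / 2 - νA))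
    -- vertex B
    (THB : Terms (Orb (Fin N))) (hHB : termOp d THB = (hubbardTTPrimeFermionInteraction 1 (sB : ℝ) (U : ℝ)).localHamiltonian Λ')
    (TEB : Terms (Orb (Fin N)))
    (hEB : termOp d TEB = fermionEmbed (PolySite.incl h0) ((hubbardTTPrimeFermionInteraction 1 (sB : ℝ) (U : ℝ)).meanEnergyObs 1))
    (TXB : Terms (Orb (Fin N))) (hXB : termOp d TXB = fermionEmbed (PolySite.incl h7) (X (sB : ℝ)))
    (μB : Fin 2 → ℚ) (νB κB capB κB' flB : ℚ)
    (KB : ℕ) (blocksB : List (List (List ℤ × Terms (Orb (Fin N)))))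
    (CWB : Terms (Orb (Fin N))) (hcwB : ∀ wc ∈ CWB, chargeW wc.1 ≠ 0 ∨ spinChargeW sp wc.1 ≠ 0)
    (AVB : List (Terms (Orb (Fin N))))
    (nsB : List ℕ) (MB : ℕ) (CsB : List SOSDual.EncPoly) (hC0B : CsB.getD 0 [] = []) (HsB : List (List (QHint Nβ)))
    (hchainB : ChainQAOK D Bkey MB CsB
      (groupSlices (residTGslices TXB μB νB o κB capB κB' flB TEB (gramTBslices KB blocksB) THB D.f EB
        (fun l : Fin 0 => l.elim0) (fun l : Fin 0 => l.elim0) CWB AVB) nsB) HsB)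
    {βB : ℚ} (hβB : βB ≤ lowerConst (SOSDual.decPoly N (CsB.getD MB [])) + (μB 0 + μB 1) * (n₀ / 2 - νB)) :
    SquareTTPrimePinnedPairRowT (U : ℝ) (n₀ : ℝ) (sA : ℝ) (sB : ℝ) capA capB flA flB βA κA κA' βB κB κB' X := by
  -- vertex A: accepted family, adjoint generators, licences, semantic residual (full eom slices)
  set TsA := groupSlices (residTGslices TXA μA νA o κA capA κA' flA TEA (gramTBslices KA blocksA) THA D.f EB
    (fun l : Fin 0 => l.elim0) (fun l : Fin 0 => l.elim0) CWA AVA) nsA with hTsA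
  set LA := allMovesZ D Bkey TsA HsA MA with hLA
  set LAA := allAdj D Bkey TsA HsA MA with hLAA
  have hLokA : ∀ n, ∀ mv ∈ allMovesZ D Bkey TsA HsA n, D.ok mv.1 mv.2.1 = true := by
    intro n
    induction n with
    | zero => intro mv hmv; rw [allMovesZ_zero] at hmv; exact absurd hmv List.not_mem_nil
    | succ n ih =>
      intro mv hmv
      rw [allMovesZ_succ, List.mem_append] at hmv
      rcases hmv with hmv | hmv
      · exact ih mv hmv
      · rw [movesOfZ, quotMovesZ, List.mem_filterMap] at hmv
        obtain ⟨a, ha, hmap⟩ := hmv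
        obtain ⟨e, hae, hFe⟩ := Option.map_eq_some_iff.1 hmap
        obtain ⟨hok, -, -⟩ := annotate_ok D Bkey _ _ a ha e hae
        rw [← hFe]
        exact hok
  let γfA : Fin LA.length → DihedralGroup 4 := fun l => d4OfCode (LA.get l).1
  let wvfA : Fin LA.length → Site 2 := fun l => siteOfPair (LA.get l).2.1
  let gfA : Fin LA.length → Orb (Fin Nβ) → Orb (Fin N) := fun l => gq D (γfA l) (wvfA l)
  let SYfA : Fin LA.length → Terms (Orb (Fin Nβ)) := fun l => (LA.get l).2.2
  have hshA : ∀ l, d4ShiftSet (γfA l) (wvfA l) Λ ⊆ Λ' := fun l =>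
    shiftSet_subset_of_table D hxs hcovβ (γfA l) (wvfA l) (hokV _ _ (hLokA MA _ (List.get_mem LA l)))
  have hgA : ∀ l b, d (gfA l b) = Orb.embMap (PolySite.incl (hshA l)) (Orb.embMap (PolySite.d4Emb (γfA l) (wvfA l) Λ) (dΛ b)) :=
    fun l b => by rw [← orb_ofLex_eq b]; exact d_gq D hxs d hdx hix hxsβ dΛ hdΛ (γfA l) (wvfA l) (hshA l) _ _
  have hTGA : termOp d (gramTBslices KA blocksA).flatten = gramForm (gramTBCoef KA blocksA) (gramTBOp d blocksA) := by
    rw [flatten_gramTBslices, termOp_gramTB_eq_gramForm]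
  have hRA : evalPoly d (SOSDual.decPoly N (CsA.getD MA [])) = termOp d
      (residTG TXA μA νA o κA capA κA' flA TEA (gramTBslices KA blocksA).flatten THA D.f EB gfA SYfA CWA (AVA ++ LAA)) := by
    rw [evalPoly_chainQA_nil hd hC0A hchainA, hTsA, flatten_groupSlices, flatten_residTGslices,
      termOp_residTG_moves_adj d TXA μA νA o κA capA κA' flA TEA _ THA D.f EB gfA SYfA CWA AVA LAA, ← hLA, ← hLAA,
      termOp_symTL_eq]
  -- vertex B: accepted family, adjoint generators, licences, semantic residual (full eom slices)
  set TsB := groupSlices (residTGslices TXB μB νB o κB capB κB' flB TEB (gramTBslices KB blocksB) THB D.f EB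
    (fun l : Fin 0 => l.elim0) (fun l : Fin 0 => l.elim0) CWB AVB) nsB with hTsB
  set LB := allMovesZ D Bkey TsB HsB MB with hLB
  set LAB := allAdj D Bkey TsB HsB MB with hLAB
  have hLokB : ∀ n, ∀ mv ∈ allMovesZ D Bkey TsB HsB n, D.ok mv.1 mv.2.1 = true := by
    intro n
    induction n with
    | zero => intro mv hmv; rw [allMovesZ_zero] at hmv; exact absurd hmv List.not_mem_nil
    | succ n ih =>
      intro mv hmv
      rw [allMovesZ_succ, List.mem_append] at hmv
      rcases hmv with hmv | hmv
      · exact ih mv hmv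
      · rw [movesOfZ, quotMovesZ, List.mem_filterMap] at hmv
        obtain ⟨a, ha, hmap⟩ := hmv
        obtain ⟨e, hae, hFe⟩ := Option.map_eq_some_iff.1 hmap
        obtain ⟨hok, -, -⟩ := annotate_ok D Bkey _ _ a ha e hae
        rw [← hFe]
        exact hok
  let γfB : Fin LB.length → DihedralGroup 4 := fun l => d4OfCode (LB.get l).1
  let wvfB : Fin LB.length → Site 2 := fun l => siteOfPair (LB.get l).2.1
  let gfB : Fin LB.length → Orb (Fin Nβ) → Orb (Fin N) := fun l => gq D (γfB l) (wvfB l)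
  let SYfB : Fin LB.length → Terms (Orb (Fin Nβ)) := fun l => (LB.get l).2.2
  have hshB : ∀ l, d4ShiftSet (γfB l) (wvfB l) Λ ⊆ Λ' := fun l =>
    shiftSet_subset_of_table D hxs hcovβ (γfB l) (wvfB l) (hokV _ _ (hLokB MB _ (List.get_mem LB l)))
  have hgB : ∀ l b, d (gfB l b) = Orb.embMap (PolySite.incl (hshB l)) (Orb.embMap (PolySite.d4Emb (γfB l) (wvfB l) Λ) (dΛ b)) :=
    fun l b => by rw [← orb_ofLex_eq b]; exact d_gq D hxs d hdx hix hxsβ dΛ hdΛ (γfB l) (wvfB l) (hshB l) _ _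
  have hTGB : termOp d (gramTBslices KB blocksB).flatten = gramForm (gramTBCoef KB blocksB) (gramTBOp d blocksB) := by
    rw [flatten_gramTBslices, termOp_gramTB_eq_gramForm]
  have hRB : evalPoly d (SOSDual.decPoly N (CsB.getD MB [])) = termOp d
      (residTG TXB μB νB o κB capB κB' flB TEB (gramTBslices KB blocksB).flatten THB D.f EB gfB SYfB CWB (AVB ++ LAB)) := by
    rw [evalPoly_chainQA_nil hd hC0B hchainB, hTsB, flatten_groupSlices, flatten_residTGslices,
      termOp_residTG_moves_adj d TXB μB νB o κB capB κB' flB TEB _ THB D.f EB gfB SYfB CWB AVB LAB, ← hLB, ← hLAB,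
      termOp_symTL_eq]
  exact SquareTTPrimePinnedPairRowT.of_residPolys_wide U hU n₀ hn0 hn2 sA sB h7 hΛ h8 h0 hz d dΛ D.f hf sp hsp o ho X EB
    THA hHA TEA hEA TXA hXA μA νA κA capA κA' flA (gramTBslices KA blocksA).flatten (gramTBCoef_posSemidef KA blocksA)
    (gramTBOp d blocksA) hTGA γfA wvfA hshA gfA hgA SYfA CWA hcwA (AVA ++ LAA) hRA hβA
    THB hHB TEB hEB TXB hXB μB νB κB capB κB' flB (gramTBslices KB blocksB).flatten (gramTBCoef_posSemidef KB blocksB)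
    (gramTBOp d blocksB) hTGB γfB wvfB hshB gfB hgB SYfB CWB hcwB (AVB ++ LAB) hRB hβB

end KernelPairChainQuotAdjTB

end Summit.Ventures.CertifiedManyBodySolver.Downfold

end
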